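import Summits.PneNP.PneNP.Theorems.UniformStreamUniformStreamLBStubStreamLoopRun2
import HarnessLib

/-!
# The streaming loop machine, IV: the trajectory and the stub `stub_streamLoop`

Route `UniformStream`, crux `UniformStreamLB` (stmt-PneNP-16045), line `birth`: the registered stub
`stub_streamLoop` (`--supports stmt-PneNP-16045`), concluding
`UniformStreamUniformStreamLBStubStreamLoopMachine.lean` / `…Run.lean` / `…Run2.lean`.

**Theorem (`stub_streamLoop`).** Let `M : TM2ComputableAux Bool Bool`, `cnt init : ℕ → List Bool`,
`upd`, `acc`, `S B : ℕ → ℕ` with `cnt 0 = []`, `|cnt n| ≤ B N` (`n ≤ N`), and within `B N` steps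
`M : 00·cnt n ↦ cnt (n+1)` (`n < N`), `01·cnt N ↦ init N`, `10·b·st ↦ upd N st b` and
`11·st ↦ [acc N st]` on states of length `≤ S N ≤ B N` (preserved by `upd N`). If
`acc N (foldl (upd N) (init N) x) = true ↔ x ∈ L` (`N = |x|`), then `L ∈ DTISP (N ↦ N · B N + B N) B`.

*Proof.* The streaming loop machine `StreamLoop.streamSM M` decides `L`: on input `x` its trajectory
(`traj`) is the counting phase (`count_phase`: `N` rounds of `≤ 3 B N + 4` steps moving the read-only
head right), the rewind (`rewind_runs`, `N + 1` steps), the initialising round (`init_round`), the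
streaming phase (`stream_phase`: `N` rounds computing the left fold) and the accepting round
(`accept_round`) — at most `16 (N · B N + B N) + 16` steps (`B N ≥ 1` since a halting computation takes
a step, `pos_of_outputsWithin`) — through configurations of work space `≤ Wb = B N + 3 + #stacks·D·B N`
(`gd_run`: a `B N`-step run of `M` on a word of length `≤ B N + 3` touches `≤ #stacks · D · B N` new
cells, `SpaceLoop.stkLen_le_of_iterate`, Arora–Barak 2009, Thm. 4.2) satisfying `reverse LEFT ++ IN = x`
(local notation `Gd⟪M, W, x⟫`). The trajectory ends in a halting configuration, so every reachable
configuration lies on it (`SpaceLoop.RunsVia.forall_reaches`): this gives input preservation and the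
space bound; the single constant `c = 16 + #stacks · D` serves both bounds of `DTISP` (Arora–Barak
2009, Def. 4.1, §4.1 "space can be reused", Def. 5.10).

## References

* S. Arora, B. Barak, *Computational Complexity: A Modern Approach*, CUP 2009, Def. 4.1 (space
  bounded computation, read-only input), §4.1 (space is reused), Thm. 4.2, Def. 5.10 (TISP).
  [AroraBarak2009]
* Mathlib, `Mathlib/Computability/TuringMachine/Computable.lean` (`FinTM2`, `initList`, `haltList`).
-/

set_option linter.dupNamespace false

noncomputable section

namespace Summit.PneNP.PneNP.Theorems.UniformStreamLB.Birth

namespace StreamLoop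

open Literature.Computability.Complexity Literature.Computability.Complexity.TM2Comp
  Literature.Computability.Complexity.SpaceLoop Turing StateTransition Function

/-! ### Notation: counted runs through a predicate; good configurations -/

/-- `RunsIn⟪C, f, P, a, b, m⟫`: a run of `f` from `a` to `b` all of whose configurations satisfy `P`
(`SpaceLoop.RunsVia`) together with the step budget `m` (`TM2Iter.ReachesIn`). -/
local notation "RunsIn⟪" C ", " f ", " P ", " a ", " b ", " m "⟫" =>
  (@SpaceLoop.RunsVia C f P a b ∧ @TM2Iter.ReachesIn C f a b m)

/-- `Gd⟪M, W, x⟫`: the good configurations for input `x` and work-space bound `W` — work space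
`wsp ≤ W` and the read-only input invariant `reverse LEFT ++ IN = x`. -/
local notation "Gd⟪" M ", " W ", " x "⟫" => (fun c : Conf M =>
  wsp M c ≤ W ∧ List.reverse (TM2.Cfg.stk c (Sum.inr Aux.LEFT)) ++ TM2.Cfg.stk c (Sum.inr Aux.IN) = x)


/-! ### The trajectory of the streaming loop machine on the data of the stub -/

section Specific

variable (Mx : TM2ComputableAux Bool Bool) (cnt ini : ℕ → List Bool)
  (upd : ℕ → List Bool → Bool → List Bool) (acc : ℕ → List Bool → Bool) (S B : ℕ → ℕ)

/-- **Rewinding the read-only head.** [folklore] -/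
theorem rewind_runs (hcntB : ∀ N n : ℕ, n ≤ N → (cnt n).length ≤ B N) (x : List Bool) :
    RunsIn⟪Conf Mx.tm, (streamTM Mx.tm Mx.inputAlphabet Mx.outputAlphabet).step,
      Gd⟪Mx.tm, Wb Mx B x.length, x⟫,
      conf Mx.tm (some (Sum.inr Lbl.rew)) Mx.tm.initialState Ph.count (botStk Mx.tm) []
        x.reverse (cnt x.length).reverse,
      conf Mx.tm (some (Sum.inr Lbl.feed)) Mx.tm.initialState Ph.init (botStk Mx.tm) x []
        (cnt x.length).reverse,
      x.length + 1⟫ := by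
  have hW := le_Wb Mx B x.length
  have hl := hcntB x.length x.length le_rfl
  have h := rew_runs Mx.tm Mx.inputAlphabet Mx.outputAlphabet Gd⟪Mx.tm, Wb Mx B x.length, x⟫
    Mx.tm.initialState Ph.count (botStk Mx.tm) (cnt x.length).reverse x.reverse []
    (fun l₁ l₂ h => gd_conf Mx.tm (by simp; omega)
      (by rw [List.append_nil, ← List.reverse_append, h, List.reverse_reverse]))
    (gd_conf Mx.tm (by simp; omega) (by simp))
  simpa using h

/-- **The initialising round.** [folklore] -/
theorem init_round (hcntB : ∀ N n : ℕ, n ≤ N → (cnt n).length ≤ B N)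
    (hiniRun : ∀ N : ℕ, Mx.OutputsWithin (false :: true :: cnt N) (ini N) (B N))
    (hiniS : ∀ N : ℕ, (ini N).length ≤ S N) (hSB : ∀ N : ℕ, S N ≤ B N) (x : List Bool) :
    RunsIn⟪Conf Mx.tm, (streamTM Mx.tm Mx.inputAlphabet Mx.outputAlphabet).step,
      Gd⟪Mx.tm, Wb Mx B x.length, x⟫,
      conf Mx.tm (some (Sum.inr Lbl.feed)) Mx.tm.initialState Ph.init (botStk Mx.tm) x []
        (cnt x.length).reverse,
      conf Mx.tm (some (Sum.inr Lbl.strm)) Mx.tm.initialState Ph.init (botStk Mx.tm) x []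
        (ini x.length).reverse,
      3 * B x.length + 3⟫ := by
  have hW := le_Wb Mx B x.length
  have hl0 := hcntB x.length x.length le_rfl
  have hl1 : (ini x.length).length ≤ B x.length := (hiniS _).trans (hSB _)
  obtain ⟨n, hnB, hrun, hgd⟩ := gd_run Mx (hiniRun x.length) (by simp; omega) x x [] (by simp)
    Ph.init
  exact round_runs Mx.tm Mx.inputAlphabet Mx.outputAlphabet Gd⟪Mx.tm, Wb Mx B x.length, x⟫
    Ph.init (by intro h; cases h) x [] (cnt x.length) (ini x.length)
    (false :: true :: cnt x.length) rfl hrun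
    (fun t₁ t₂ h => gd_conf Mx.tm
      (by have := congrArg List.length h; simp at this ⊢; omega) (by simp))
    hgd
    (fun L₁ L₂ h => gd_conf Mx.tm
      (by have := congrArg List.length h; simp at this ⊢; omega) (by simp))
    (gd_conf Mx.tm (by simp; omega) (by simp))
    (by omega)

/-- **One streaming round.** [folklore] -/
theorem stream_round
    (hupdS : ∀ (N : ℕ) (st : List Bool) (b : Bool), st.length ≤ S N → (upd N st b).length ≤ S N)
    (hupdRun : ∀ (N : ℕ) (st : List Bool) (b : Bool), st.length ≤ S N →
      Mx.OutputsWithin (true :: false :: b :: st) (upd N st b) (B N))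
    (hSB : ∀ N : ℕ, S N ≤ B N) (x i₁ i₂ : List Bool) (b : Bool) (hx : i₁ ++ b :: i₂ = x) (p : Ph)
    (st : List Bool) (hst : st.length ≤ S x.length) :
    RunsIn⟪Conf Mx.tm, (streamTM Mx.tm Mx.inputAlphabet Mx.outputAlphabet).step,
      Gd⟪Mx.tm, Wb Mx B x.length, x⟫,
      conf Mx.tm (some (Sum.inr Lbl.strm)) Mx.tm.initialState p (botStk Mx.tm) (b :: i₂)
        i₁.reverse st.reverse,
      conf Mx.tm (some (Sum.inr Lbl.strm)) Mx.tm.initialState (Ph.stream b) (botStk Mx.tm) i₂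
        (b :: i₁.reverse) (upd x.length st b).reverse,
      3 * B x.length + 4⟫ := by
  have hW := le_Wb Mx B x.length
  have hS := hSB x.length
  have hl1 := hupdS x.length st b hst
  obtain ⟨n, hnB, hrun, hgd⟩ := gd_run Mx (hupdRun x.length st b hst) (by simp; omega) x i₂
    (b :: i₁.reverse) (by simp [← hx]) (Ph.stream b)
  have e0 := st_strm_cons Mx.tm Mx.inputAlphabet Mx.outputAlphabet Mx.tm.initialState p
    (botStk Mx.tm) i₂ i₁.reverse st.reverse b
  have hr := round_runs Mx.tm Mx.inputAlphabet Mx.outputAlphabet Gd⟪Mx.tm, Wb Mx B x.length, x⟫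
    (Ph.stream b) (by intro h; cases h) i₂ (b :: i₁.reverse) st (upd x.length st b)
    (true :: false :: b :: st) rfl (m := 3 * B x.length + 3) hrun
    (fun t₁ t₂ h => gd_conf Mx.tm
      (by have := congrArg List.length h; simp at this ⊢; omega) (by simp [← hx]))
    hgd
    (fun L₁ L₂ h => gd_conf Mx.tm
      (by have := congrArg List.length h; simp at this ⊢; omega) (by simp [← hx]))
    (gd_conf Mx.tm (by simp; omega) (by simp [← hx]))
    (by omega)
  exact rin_mono (rin_step_trans (P := Gd⟪Mx.tm, Wb Mx B x.length, x⟫) e0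
    (gd_conf Mx.tm (by simp; omega) (by simp [← hx])) hr) (by omega)

/-- **The streaming phase**: one streaming round per remaining input bit (the state is the left
fold of `upd N`), then `strm` finds the input exhausted and enters the accepting round. [folklore] -/
theorem stream_phase
    (hupdS : ∀ (N : ℕ) (st : List Bool) (b : Bool), st.length ≤ S N → (upd N st b).length ≤ S N)
    (hupdRun : ∀ (N : ℕ) (st : List Bool) (b : Bool), st.length ≤ S N →
      Mx.OutputsWithin (true :: false :: b :: st) (upd N st b) (B N))
    (hSB : ∀ N : ℕ, S N ≤ B N) (x : List Bool) : ∀ (i₂ i₁ : List Bool), i₁ ++ i₂ = x →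
    ∀ (p : Ph) (st : List Bool), st.length ≤ S x.length →
    RunsIn⟪Conf Mx.tm, (streamTM Mx.tm Mx.inputAlphabet Mx.outputAlphabet).step,
      Gd⟪Mx.tm, Wb Mx B x.length, x⟫,
      conf Mx.tm (some (Sum.inr Lbl.strm)) Mx.tm.initialState p (botStk Mx.tm) i₂ i₁.reverse
        st.reverse,
      conf Mx.tm (some (Sum.inr Lbl.feed)) Mx.tm.initialState Ph.accept (botStk Mx.tm) []
        x.reverse (i₂.foldl (upd x.length) st).reverse,
      i₂.length * (3 * B x.length + 4) + 1⟫
  | [], i₁, hx, p, st, hst => by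
    rw [List.append_nil] at hx
    subst hx
    have hW := le_Wb Mx B i₁.length
    have hS := hSB i₁.length
    simpa using rin_single (P := Gd⟪Mx.tm, Wb Mx B i₁.length, i₁⟫)
      (st_strm_nil Mx.tm Mx.inputAlphabet Mx.outputAlphabet
        Mx.tm.initialState p (botStk Mx.tm) i₁.reverse st.reverse)
      (gd_conf Mx.tm (by simp; omega) (by simp)) (gd_conf Mx.tm (by simp; omega) (by simp))
  | b :: i₂, i₁, hx, p, st, hst => by
    have h1 := stream_round Mx upd S B hupdS hupdRun hSB x i₁ i₂ b hx p st hst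
    have h2 := stream_phase hupdS hupdRun hSB x i₂ (i₁ ++ [b]) (by simpa using hx) (Ph.stream b)
      (upd x.length st b) (hupdS _ _ _ hst)
    rw [show (i₁ ++ [b]).reverse = b :: i₁.reverse by simp] at h2
    refine rin_mono (rin_trans h1 h2) (le_of_eq ?_)
    simp only [List.length_cons]
    ring

/-- **The accepting round** on the final state `st`. [folklore] -/
theorem accept_round
    (haccRun : ∀ (N : ℕ) (st : List Bool), st.length ≤ S N →
      Mx.OutputsWithin (true :: true :: st) [acc N st] (B N))
    (hSB : ∀ N : ℕ, S N ≤ B N) (x st : List Bool) (hst : st.length ≤ S x.length) :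
    RunsIn⟪Conf Mx.tm, (streamTM Mx.tm Mx.inputAlphabet Mx.outputAlphabet).step,
      Gd⟪Mx.tm, Wb Mx B x.length, x⟫,
      conf Mx.tm (some (Sum.inr Lbl.feed)) Mx.tm.initialState Ph.accept (botStk Mx.tm) []
        x.reverse st.reverse,
      (⟨none, (Mx.tm.initialState, none, Ph.accept),
        mkStk (update (botStk Mx.tm) Mx.tm.k₁ [Mx.outputAlphabet.symm (acc x.length st)]) []
          x.reverse [] []⟩ : Conf Mx.tm),
      2 * B x.length + 2⟫ := by
  have hW := le_Wb Mx B x.length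
  have hS := hSB x.length
  obtain ⟨n, hnB, hrun, hgd⟩ := gd_run Mx (haccRun x.length st hst) (by simp; omega) x []
    x.reverse (by simp) Ph.accept
  exact accept_runs Mx.tm Mx.inputAlphabet Mx.outputAlphabet Gd⟪Mx.tm, Wb Mx B x.length, x⟫
    [] x.reverse st (true :: true :: st) rfl (acc x.length st) hrun
    (fun t₁ t₂ h => gd_conf Mx.tm
      (by have := congrArg List.length h; simp at this ⊢; omega) (by simp))
    hgd
    (gd_mk Mx.tm (by simp; omega) (by simp))
    (by omega)

/-- **The full trajectory.** From its initial configuration on `x` the streaming loop machine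
halts with the verdict `acc N (foldl (upd N) (init N) x)` on the output stack of the round machine,
within `16 (N · B N + B N) + 16` steps, through good configurations.
[cite: AroraBarak2009, Def. 4.1, §4.1 and Def. 5.10 (TISP)] -/
theorem traj (hcnt0 : cnt 0 = [])
    (hcntB : ∀ N n : ℕ, n ≤ N → (cnt n).length ≤ B N)
    (hcntRun : ∀ N n : ℕ, n < N → Mx.OutputsWithin (false :: false :: cnt n) (cnt (n + 1)) (B N))
    (hiniRun : ∀ N : ℕ, Mx.OutputsWithin (false :: true :: cnt N) (ini N) (B N))
    (hiniS : ∀ N : ℕ, (ini N).length ≤ S N)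
    (hupdS : ∀ (N : ℕ) (st : List Bool) (b : Bool), st.length ≤ S N → (upd N st b).length ≤ S N)
    (hupdRun : ∀ (N : ℕ) (st : List Bool) (b : Bool), st.length ≤ S N →
      Mx.OutputsWithin (true :: false :: b :: st) (upd N st b) (B N))
    (haccRun : ∀ (N : ℕ) (st : List Bool), st.length ≤ S N →
      Mx.OutputsWithin (true :: true :: st) [acc N st] (B N))
    (hSB : ∀ N : ℕ, S N ≤ B N) (x : List Bool) :
    RunsIn⟪Conf Mx.tm, (streamTM Mx.tm Mx.inputAlphabet Mx.outputAlphabet).step,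
      Gd⟪Mx.tm, Wb Mx B x.length, x⟫,
      (streamSM Mx.tm Mx.inputAlphabet Mx.outputAlphabet).init x,
      (⟨none, (Mx.tm.initialState, none, Ph.accept),
        mkStk (update (botStk Mx.tm) Mx.tm.k₁ [Mx.outputAlphabet.symm
          (acc x.length (x.foldl (upd x.length) (ini x.length)))]) [] x.reverse [] []⟩ : Conf Mx.tm),
      16 * (x.length * B x.length + B x.length) + 16⟫ := by
  rw [streamSM_init]
  have hB : 1 ≤ B x.length := pos_of_outputsWithin (hiniRun x.length)
  have h1 := count_phase Mx cnt B hcntB hcntRun x x [] rfl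
  rw [List.reverse_nil, List.length_nil, hcnt0, List.reverse_nil] at h1
  have h2 := rewind_runs Mx cnt B hcntB x
  have h3 := init_round Mx cnt ini S B hcntB hiniRun hiniS hSB x
  have h4 := stream_phase Mx upd S B hupdS hupdRun hSB x x [] rfl Ph.init (ini x.length) (hiniS _)
  rw [List.reverse_nil] at h4
  have h5 := accept_round Mx acc S B haccRun hSB x (x.foldl (upd x.length) (ini x.length))
    (length_foldl_le x.length (hupdS x.length) x (ini x.length) (hiniS _))
  refine rin_mono (rin_trans (rin_trans (rin_trans (rin_trans h1 h2) h3) h4) h5) ?_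
  have e1 : x.length * (3 * B x.length + 4) = 3 * (x.length * B x.length) + 4 * x.length := by ring
  have e2 : x.length ≤ x.length * B x.length := Nat.le_mul_of_pos_right _ hB
  omega

end Specific

end StreamLoop

open Literature.Computability.Complexity Literature.Computability.Complexity.TM2Comp
  Literature.Computability.Complexity.SpaceLoop Turing StateTransition Function StreamLoop

/-- **The generic streaming loop (stub `stub_streamLoop`).** Let one round machine `M` implement,
behind a two-bit tag protocol, a counter (`00·cnt n ↦ cnt (n+1)`), an initial state
(`01·cnt N ↦ init N`), a state update (`10·b·st ↦ upd N st b`) and an acceptance test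
(`11·st ↦ [acc N st]`), each within `B N` steps on states of length `≤ S N ≤ B N` and counter
words of length `≤ B N`. Then the language of the words `x` accepted by the one-pass streaming
algorithm `acc N (foldl (upd N) (init N) x)`, `N = |x|`, is decided by ONE input-preserving space
machine simultaneously in time `O(N · B N + B N)` and work space `O(B N)`: it lies in
`DTISP (N · B N + B N) (B N)`. The machine is `StreamLoop.streamSM`: it counts the input symbols
while moving the read-only head right (feeding `M` the counter words), rewinds, and streams the
input through `M` once, reusing the space of one round.
[cite: AroraBarak2009, Def. 4.1 and §4.1 (space-bounded machines with read-only input; reuse of space), Def. 5.10 (TISP)] -/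
theorem stub_streamLoop :
    ∀ (M : Turing.TM2ComputableAux Bool Bool) (cnt init : ℕ → List Bool)
      (upd : ℕ → List Bool → Bool → List Bool) (acc : ℕ → List Bool → Bool)
      (S B : ℕ → ℕ) (L : Language Bool),
      cnt 0 = [] →
      (∀ N n : ℕ, n ≤ N → (cnt n).length ≤ B N) →
      (∀ N n : ℕ, n < N → M.OutputsWithin (false :: false :: cnt n) (cnt (n + 1)) (B N)) →
      (∀ N : ℕ, M.OutputsWithin (false :: true :: cnt N) (init N) (B N)) →
      (∀ N : ℕ, (init N).length ≤ S N) →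
      (∀ (N : ℕ) (st : List Bool) (b : Bool), st.length ≤ S N → (upd N st b).length ≤ S N) →
      (∀ (N : ℕ) (st : List Bool) (b : Bool), st.length ≤ S N →
        M.OutputsWithin (true :: false :: b :: st) (upd N st b) (B N)) →
      (∀ (N : ℕ) (st : List Bool), st.length ≤ S N →
        M.OutputsWithin (true :: true :: st) [acc N st] (B N)) →
      (∀ N : ℕ, S N ≤ B N) →
      (∀ x : List Bool, acc x.length (x.foldl (upd x.length) (init x.length)) = true ↔ x ∈ L) →
      L ∈ Literature.Computability.Complexity.DTISP (fun N => N * B N + B N) (fun N => B N) := by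
  intro M cnt ini upd acc S B L hcnt0 hcntB hcntRun hiniRun hiniS hupdS hupdRun haccRun hSB hL
  have T := traj M cnt ini upd acc S B hcnt0 hcntB hcntRun hiniRun hiniS hupdS hupdRun haccRun hSB
  -- the halting configuration does not move
  have hnone : ∀ x : List Bool, (streamTM M.tm M.inputAlphabet M.outputAlphabet).step
      (⟨none, (M.tm.initialState, none, Ph.accept),
        mkStk (update (botStk M.tm) M.tm.k₁ [M.outputAlphabet.symm
          (acc x.length (x.foldl (upd x.length) (ini x.length)))]) [] x.reverse [] []⟩ : Conf M.tm) =
      none := fun x => rfl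
  refine ⟨16 + nStk M.tm * machinePushBound M.tm, streamSM M.tm M.inputAlphabet M.outputAlphabet,
    fun x c hc => ?_, fun x => ⟨⟨_, ?_, hnone x, ?_⟩, fun c hc => ?_⟩⟩
  · -- read-only input
    obtain ⟨-, hg⟩ := (T x).1.forall_reaches (hnone x) c hc
    have e : ∀ l : List Bool, List.map (⇑(Equiv.refl Bool)) l = l := fun l =>
      List.map_id'' (fun _ => rfl) l
    show (List.map (⇑(Equiv.refl Bool)) (c.stk (Sum.inr Aux.LEFT))).reverse ++
      List.map (⇑(Equiv.refl Bool)) (c.stk (Sum.inr Aux.IN)) = x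
    rw [e, e]
    exact hg
  · -- halting in time
    obtain ⟨n, hn, e⟩ := (T x).2
    refine ⟨⟨⟨n, e⟩, hn.trans ?_⟩⟩
    show 16 * (x.length * B x.length + B x.length) + 16 ≤
      (16 + nStk M.tm * machinePushBound M.tm) * (x.length * B x.length + B x.length) +
        (16 + nStk M.tm * machinePushBound M.tm)
    exact Nat.add_le_add (Nat.mul_le_mul_right _ (Nat.le_add_right _ _)) (Nat.le_add_right _ _)
  · -- the verdict
    show List.map (⇑M.outputAlphabet) (mkStk (update (botStk M.tm) M.tm.k₁ [M.outputAlphabet.symm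
      (acc x.length (x.foldl (upd x.length) (ini x.length)))]) [] x.reverse [] [] (Sum.inl M.tm.k₁)) =
      Computability.encodeBool (L.boolIndicator x)
    rw [mkStk_inl, update_self, List.map_cons, List.map_nil, Equiv.apply_symm_apply]
    show [acc x.length (x.foldl (upd x.length) (ini x.length))] = [L.boolIndicator x]
    by_cases hx : x ∈ L
    · rw [(Set.mem_iff_boolIndicator _ _).1 hx, (hL x).2 hx]
    · rw [(Set.notMem_iff_boolIndicator _ _).1 hx]
      cases h : acc x.length (x.foldl (upd x.length) (ini x.length)) with
      | false => rfl
      | true => exact absurd ((hL x).1 h) hx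
  · -- space
    obtain ⟨hg, -⟩ := (T x).1.forall_reaches (hnone x) c hc
    rw [workSpace_eq_wsp]
    exact hg.trans (Wb_le M B x.length)

end Summit.PneNP.PneNP.Theorems.UniformStreamLB.Birth
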